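/-
Copyright (c) 2026 the pub-hodgecm-mathlib formalisation cell (harness21).  Prover seat hodgecm-mathlib-K2E2-p12 (g10), Track B «K2-LIT», h413 = `stmt-HodgeConjecture-24833`,
route `HCCMUnconditional`; R90-TF section S8 «ContSpec-n½», deal S8-R244 (S8 dealer R90-CS-plan (g3)): THE ARCHIMEDEAN AMPLITUDE OF A BOUNDED WEIGHT — the holomorphy half of
`harchτ` for an archimedean big-cell weight of ANY bound `M` (the reading of a `K_∞`-finite vector of sup-norm `M`), and its bound by `M ×` the spherical archimedean value;
census `R90/S8/CENSUS-ArchAmplitude.K2E2-p12-g10.md` b6c4c6e9a27fbb65.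
-/
import Summits.HodgeConjecture.HodgeConjecture.Theorems.K2E1ChiIntertwiningLocalFactorHolomorphicU3   -- ★ (a-3) (R90-CS-p03): the arch heads at `‖ω_∞‖ ≤ 1`, `continuous_arch`, the finite local means; brings ★ `one_le_arch`, ★ `integrable_arch_rpow_neg_prod_real`
import HarnessLib

/-!
# h413 ∕ R90-S8 — `K2E1ChiArchAmplitudeOfKTypeVectorU3`: THE ARCHIMEDEAN LOCAL AMPLITUDE `z ↦ ∫ ω_∞·ARCH₃^{−z}` OF A WEIGHT OF ANY BOUND `M` IS HOLOMORPHIC ON `{1 < Re z}` AND BOUNDED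
# BY `M ×` THE SPHERICAL ARCHIMEDEAN VALUE AT `Re z` — the holomorphy half of `harchτ` for `K_∞`-finite vectors of any type and any sup-norm

Cell `pub/hodgecm-mathlib`, crux H413 = `stmt-HodgeConjecture-24833`, route `HCCMUnconditional`; R90-TF section S8, deal S8-R244.  THEOREMS ONLY (no `def`, no `instance`, no notation, no
named-fact hypothesis, no `sorry`; default heartbeats); lane `--supports stmt-HodgeConjecture-24833 --as helper` (count-neutral).  Closes no socket.

THE MATHEMATICS ([MoeglinWaldspurger1995, II.1.6–II.1.7, IV.1.11]; [Langlands1976, Appendix]; [Titchmarsh1939, §2.8]; [Knapp1986, VII §2]).  ★ (a-3) proved: for every a.e.-strongly-measurable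
archimedean big-cell weight `ω_∞ : L_∞ × L⁺_∞ → ℂ` with `‖ω_∞‖ ≤ 1`, `z ↦ ∫ ω_∞·ARCH₃^{−z} d(μ_{E,∞} ⊗ μ_{F,∞})` is holomorphic on `{1 < Re z}` (window engine, `ARCH₃ ≥ 1`, `ARCH₃^{−σ} ∈ L¹` for
`σ > 1`) — no `K_∞`-type hypothesis whatsoever.  The archimedean reading of a `K_∞`-FINITE VECTOR `Φ_∞` of type τ (any dimension) along the translated big cell, `ω_∞^{(k)}(X_∞, s_∞) =
Φ_∞((ι(w₀)u(X,θs))_∞·k_∞)`, is continuous and bounded by `M := sup |Φ_∞|` (unitary-character sections: `|Φ_∞(bκ)| = |Φ_∞(κ)|`, `κ` in the compact `K_∞`), NOT by `1`; this file removes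
the normalisation: for ANY real bound `M`, (§1) the amplitude is HOLOMORPHIC on `{1 < Re z}` (scale by `max M 1`; product and iterated forms; integrability), (§2) `‖∫ ω_∞·ARCH₃^{−z}‖ ≤
M·∫ ARCH₃^{−Re z}` — `M ×` THE SPHERICAL ARCHIMEDEAN VALUE at `Re z` —, and (§3) ★ (a-3)'s full χ-amplitude `C·(∫∫ ω_∞·ARCH₃^{−z})·∏_{v∈S₀} m_v(z)` stays holomorphic with `‖ω_∞‖ ≤ M`.
The VALUE of the archimedean intertwiner on the type (Gamma factors; Schur on a multiplicity-one `K_∞`-type — K2E3-p29 (g4)'s file) is neither claimed nor needed here.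
* §1 **`integrable_archAmplitude_of_norm_le`**, **`differentiableOn_archAmplitude_of_norm_le`** (product form), **`differentiableOn_integral_integral_archAmplitude_of_norm_le`** (iterated form).
* §2 **`norm_archAmplitude_le`** (product form), **`norm_integral_integral_archAmplitude_le`** (iterated form).
* §3 **`differentiableOn_chiAmplitude_three_of_norm_le`** — ★ `differentiableOn_chiAmplitude_three` with the archimedean bound `1 ↦ M`.
HONEST LABEL: HC_CM is proved only modulo the 7 printed citations (2 remaining named inputs: hLiu418 = `stmt-HodgeConjecture-24832`, h413 = `stmt-HodgeConjecture-24833`) until rung 0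
closes; the holomorphy half of `harchτ` was ★ (a-3) at `‖ω_∞‖ ≤ 1` and is consumed by ★ `hunfK_of_core` through z-free reading letters; this file pays the normalisation and the bound only;
the discharge of the reading letters for a general bounded continuous `Φ_∞` (arch twin of ★ `finPart_heisChart_traceZeroLine_eq`) is K2E1-p14 (g5)'s `K2E1ChiArchReadingOfContinuousBoundedU3`
(ruling J-S8-ARCH); closes no socket; count-neutral.

## References
* [MoeglinWaldspurger1995] C. Mœglin, J.-L. Waldspurger, *Spectral Decomposition and Eisenstein Series* (1995), II.1.6–II.1.7, IV.1.11.
* [Langlands1976] R. P. Langlands, *On the Functional Equations Satisfied by Eisenstein Series*, LNM 544 (1976), Appendix.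
* [Titchmarsh1939] E. C. Titchmarsh, *The Theory of Functions*, 2nd ed. (1939), §2.8.
* [Knapp1986] A. W. Knapp, *Representation Theory of Semisimple Groups* (1986), VII §2.
-/

set_option autoImplicit false
set_option linter.dupNamespace false  -- the mandated namespace repeats the summit's segment (`HodgeConjecture.HodgeConjecture`)

noncomputable section

open MeasureTheory MeasureTheory.Measure NumberField NumberField.InfinitePlace IsDedekindDomain Filter
open scoped NNReal ENNReal
open Literature.NumberTheory.Automorphic Literature.NumberTheory.Automorphic.UnitaryGroup Literature.NumberTheory.GaloisRepresentations
open Literature.NumberTheory.GaloisRepresentations.IsNonarchimedeanLocalField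
open Summit.HodgeConjecture.HodgeConjecture.Cruxes.H413
open Summit.HodgeConjecture.HodgeConjecture.Cruxes.H413.K2E1IntertwiningArchFactorIntegrableU3 (one_le_arch integrable_arch_rpow_neg_prod_real)
open Summit.HodgeConjecture.HodgeConjecture.Cruxes.H413.K2E1ChiIntertwiningLocalFactorHolomorphicU3 (continuous_arch differentiableOn_integral_archWeight_mul_arch_cpow_neg differentiableOn_finsetProd_chiLocalMean_three)

namespace Summit.HodgeConjecture.HodgeConjecture.Cruxes.H413.K2E1ChiArchAmplitudeOfKTypeVectorU3

variable (L : Type) [Field L] [NumberField L] [IsCMField L] {δ : L} (hcδ : IsCMField.complexConj L δ = -δ) (hδ : δ ≠ 0)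
  {d : ↥(maximalRealSubfield L)} (hd : δ * δ = algebraMap ↥(maximalRealSubfield L) L d)

section Arch

variable [MeasurableSpace (InfiniteAdeleRing L)] [BorelSpace (InfiniteAdeleRing L)] [MeasurableSpace (InfiniteAdeleRing ↥(maximalRealSubfield L))] [BorelSpace (InfiniteAdeleRing ↥(maximalRealSubfield L))]
  (μE₁ : Measure (InfiniteAdeleRing L)) [μE₁.IsAddHaarMeasure] (μF₁ : Measure (InfiniteAdeleRing ↥(maximalRealSubfield L))) [μF₁.IsAddHaarMeasure]
  (ωinf : InfiniteAdeleRing L → InfiniteAdeleRing ↥(maximalRealSubfield L) → ℂ)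

/-! ## §1 Holomorphy of the archimedean amplitude of a weight of any bound -/

include hδ in
/-- **THE WEIGHTED ARCHIMEDEAN INTEGRAND IS INTEGRABLE for `1 < Re z`, for a weight of ANY bound `M`** (`‖ω_∞·ARCH₃^{−z}‖ ≤ M·ARCH₃^{−Re z}`, ★ `integrable_arch_rpow_neg_prod_real`).
[cite: MoeglinWaldspurger1995, II.1.7] -/
theorem integrable_archAmplitude_of_norm_le
    (hω : AEStronglyMeasurable (fun p : InfiniteAdeleRing L × InfiniteAdeleRing ↥(maximalRealSubfield L) => ωinf p.1 p.2) (μE₁.prod μF₁)) {M : ℝ} (hωb : ∀ Xi a, ‖ωinf Xi a‖ ≤ M)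
    {z : ℂ} (hz : 1 < z.re) :
    Integrable (fun p : InfiniteAdeleRing L × InfiniteAdeleRing ↥(maximalRealSubfield L) => ωinf p.1 p.2 * ((((∏ w : InfinitePlace L, ((1 + ‖(p.1) w‖ ^ 2 / 2) ^ 2 + (w δ) ^ 2 * (((InfiniteAdeleRing.ringEquiv_mixedSpace ↥(maximalRealSubfield L)) p.2).1 ⟨w.comap (algebraMap ↥(maximalRealSubfield L) L), K2E1HeightBigCellLineFormulaU2.isReal_comap_maximalRealSubfield L w⟩) ^ 2))) : ℝ) : ℂ) ^ (-z)) (μE₁.prod μF₁) := by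
  haveI : SecondCountableTopology (InfiniteAdeleRing L) := secondCountableTopology_infiniteAdeleRing L
  haveI : SecondCountableTopology (InfiniteAdeleRing ↥(maximalRealSubfield L)) := secondCountableTopology_infiniteAdeleRing _
  have hcont : Continuous fun p : InfiniteAdeleRing L × InfiniteAdeleRing ↥(maximalRealSubfield L) => ((((∏ w : InfinitePlace L, ((1 + ‖(p.1) w‖ ^ 2 / 2) ^ 2 + (w δ) ^ 2 * (((InfiniteAdeleRing.ringEquiv_mixedSpace ↥(maximalRealSubfield L)) p.2).1 ⟨w.comap (algebraMap ↥(maximalRealSubfield L) L), K2E1HeightBigCellLineFormulaU2.isReal_comap_maximalRealSubfield L w⟩) ^ 2))) : ℝ) : ℂ) ^ (-z) := by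
    refine (Complex.continuous_ofReal.comp (continuous_arch L (δ := δ))).cpow continuous_const fun p => ?_
    exact Complex.ofReal_mem_slitPlane.2 (lt_of_lt_of_le one_pos (one_le_arch L p.1 p.2))
  refine Integrable.mono' ((integrable_arch_rpow_neg_prod_real L hδ μE₁ μF₁ hz).const_mul M) (hω.mul hcont.aestronglyMeasurable) (Eventually.of_forall fun p => ?_)
  rw [norm_mul, Complex.norm_cpow_eq_rpow_re_of_pos (lt_of_lt_of_le one_pos (one_le_arch L p.1 p.2)), Complex.neg_re]
  exact mul_le_mul_of_nonneg_right (hωb p.1 p.2) (Real.rpow_nonneg (le_trans zero_le_one (one_le_arch L p.1 p.2)) _)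

include hδ in
/-- **`z ↦ ∫ ω_∞·ARCH₃^{−z} d(μ_{E,∞} ⊗ μ_{F,∞})` IS HOLOMORPHIC ON `{1 < Re z}` FOR A WEIGHT OF ANY BOUND `M`** — ★ (a-3) `differentiableOn_integral_archWeight_mul_arch_cpow_neg` at the
rescaled weight `(max M 1)⁻¹·ω_∞` (bound `≤ 1`), times the constant `max M 1`. The holomorphy half of `harchτ` for the reading of a `K_∞`-finite vector of any sup-norm.
[cite: Titchmarsh1939, §2.8] [cite: MoeglinWaldspurger1995, II.1.7, IV.1.11] [cite: Knapp1986, VII §2] -/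
theorem differentiableOn_archAmplitude_of_norm_le
    (hω : AEStronglyMeasurable (fun p : InfiniteAdeleRing L × InfiniteAdeleRing ↥(maximalRealSubfield L) => ωinf p.1 p.2) (μE₁.prod μF₁)) {M : ℝ} (hωb : ∀ Xi a, ‖ωinf Xi a‖ ≤ M) :
    DifferentiableOn ℂ (fun z : ℂ => ∫ p : InfiniteAdeleRing L × InfiniteAdeleRing ↥(maximalRealSubfield L), ωinf p.1 p.2 * ((((∏ w : InfinitePlace L, ((1 + ‖(p.1) w‖ ^ 2 / 2) ^ 2 + (w δ) ^ 2 * (((InfiniteAdeleRing.ringEquiv_mixedSpace ↥(maximalRealSubfield L)) p.2).1 ⟨w.comap (algebraMap ↥(maximalRealSubfield L) L), K2E1HeightBigCellLineFormulaU2.isReal_comap_maximalRealSubfield L w⟩) ^ 2))) : ℝ) : ℂ) ^ (-z) ∂(μE₁.prod μF₁)) {z : ℂ | 1 < z.re} := by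
  have hM0 : 0 < max M 1 := lt_of_lt_of_le one_pos (le_max_right _ _)
  have hMne : ((max M 1 : ℝ) : ℂ) ≠ 0 := Complex.ofReal_ne_zero.2 hM0.ne'
  -- the rescaled weight has bound `≤ 1`
  have hωb' : ∀ Xi a, ‖(fun Xi a => ((max M 1 : ℝ) : ℂ)⁻¹ * ωinf Xi a) Xi a‖ ≤ 1 := fun Xi a => by
    show ‖((max M 1 : ℝ) : ℂ)⁻¹ * ωinf Xi a‖ ≤ 1
    rw [norm_mul, norm_inv, Complex.norm_real, Real.norm_of_nonneg hM0.le]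
    calc (max M 1)⁻¹ * ‖ωinf Xi a‖ ≤ (max M 1)⁻¹ * max M 1 := mul_le_mul_of_nonneg_left ((hωb Xi a).trans (le_max_left _ _)) (inv_nonneg.2 hM0.le)
      _ = 1 := inv_mul_cancel₀ hM0.ne'
  have h := (differentiableOn_integral_archWeight_mul_arch_cpow_neg L hδ μE₁ μF₁ (fun Xi a => ((max M 1 : ℝ) : ℂ)⁻¹ * ωinf Xi a) (hω.const_mul _) hωb').const_mul
    ((max M 1 : ℝ) : ℂ)
  refine h.congr fun z _ => ?_
  rw [← integral_const_mul]
  refine integral_congr_ae (Eventually.of_forall fun p => ?_)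
  simp only [← mul_assoc, mul_inv_cancel₀ hMne, one_mul]

include hδ in
/-- **THE ITERATED FORM** `z ↦ ∫_{L_∞} ∫_{L⁺_∞} ω_∞(Ξ,a)·ARCH₃(Ξ,a)^{−z} dμ_{F,∞} dμ_{E,∞}` is holomorphic on `{1 < Re z}` for a weight of any bound (Fubini on the open half-plane, §1 integrability).
[cite: Titchmarsh1939, §2.8] [cite: MoeglinWaldspurger1995, II.1.7] -/
theorem differentiableOn_integral_integral_archAmplitude_of_norm_le
    (hω : AEStronglyMeasurable (fun p : InfiniteAdeleRing L × InfiniteAdeleRing ↥(maximalRealSubfield L) => ωinf p.1 p.2) (μE₁.prod μF₁)) {M : ℝ} (hωb : ∀ Xi a, ‖ωinf Xi a‖ ≤ M) :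
    DifferentiableOn ℂ (fun z : ℂ => ∫ Xi : InfiniteAdeleRing L, ∫ a : InfiniteAdeleRing ↥(maximalRealSubfield L), ωinf Xi a * ((((∏ w : InfinitePlace L, ((1 + ‖(Xi) w‖ ^ 2 / 2) ^ 2 + (w δ) ^ 2 * (((InfiniteAdeleRing.ringEquiv_mixedSpace ↥(maximalRealSubfield L)) a).1 ⟨w.comap (algebraMap ↥(maximalRealSubfield L) L), K2E1HeightBigCellLineFormulaU2.isReal_comap_maximalRealSubfield L w⟩) ^ 2))) : ℝ) : ℂ) ^ (-z) ∂μF₁ ∂μE₁) {z : ℂ | 1 < z.re} := by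
  haveI : SecondCountableTopology (InfiniteAdeleRing L) := secondCountableTopology_infiniteAdeleRing L
  haveI : SecondCountableTopology (InfiniteAdeleRing ↥(maximalRealSubfield L)) := secondCountableTopology_infiniteAdeleRing _
  exact (differentiableOn_archAmplitude_of_norm_le L hδ μE₁ μF₁ ωinf hω hωb).congr fun z hz =>
    (integral_prod _ (integrable_archAmplitude_of_norm_le L hδ μE₁ μF₁ ωinf hω hωb hz)).symm

/-! ## §2 The bound by `M ×` the spherical archimedean value -/

include hδ in
/-- **`‖∫ ω_∞·ARCH₃^{−z}‖ ≤ M·∫ ARCH₃^{−Re z}`** for `1 < Re z` and a weight of bound `M`: the archimedean amplitude of the reading of a `K_∞`-finite vector is bounded by its sup-norm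
times THE SPHERICAL ARCHIMEDEAN VALUE at `Re z` (the `ω_∞ = 1` integral, ★ integrable). [cite: MoeglinWaldspurger1995, II.1.7] [cite: Knapp1986, VII §2] -/
theorem norm_archAmplitude_le {M : ℝ} (hωb : ∀ Xi a, ‖ωinf Xi a‖ ≤ M) {z : ℂ} (hz : 1 < z.re) :
    ‖∫ p : InfiniteAdeleRing L × InfiniteAdeleRing ↥(maximalRealSubfield L), ωinf p.1 p.2 * ((((∏ w : InfinitePlace L, ((1 + ‖(p.1) w‖ ^ 2 / 2) ^ 2 + (w δ) ^ 2 * (((InfiniteAdeleRing.ringEquiv_mixedSpace ↥(maximalRealSubfield L)) p.2).1 ⟨w.comap (algebraMap ↥(maximalRealSubfield L) L), K2E1HeightBigCellLineFormulaU2.isReal_comap_maximalRealSubfield L w⟩) ^ 2))) : ℝ) : ℂ) ^ (-z) ∂(μE₁.prod μF₁)‖ ≤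
      M * ∫ p : InfiniteAdeleRing L × InfiniteAdeleRing ↥(maximalRealSubfield L), (∏ w : InfinitePlace L, ((1 + ‖(p.1) w‖ ^ 2 / 2) ^ 2 + (w δ) ^ 2 * (((InfiniteAdeleRing.ringEquiv_mixedSpace ↥(maximalRealSubfield L)) p.2).1 ⟨w.comap (algebraMap ↥(maximalRealSubfield L) L), K2E1HeightBigCellLineFormulaU2.isReal_comap_maximalRealSubfield L w⟩) ^ 2)) ^ (-z.re) ∂(μE₁.prod μF₁) := by
  rw [← integral_const_mul]
  refine norm_integral_le_of_norm_le ((integrable_arch_rpow_neg_prod_real L hδ μE₁ μF₁ hz).const_mul M) (Eventually.of_forall fun p => ?_)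
  rw [norm_mul, Complex.norm_cpow_eq_rpow_re_of_pos (lt_of_lt_of_le one_pos (one_le_arch L p.1 p.2)), Complex.neg_re]
  exact mul_le_mul_of_nonneg_right (hωb p.1 p.2) (Real.rpow_nonneg (le_trans zero_le_one (one_le_arch L p.1 p.2)) _)

include hδ in
/-- **THE ITERATED FORM OF THE BOUND**: `‖∫_{L_∞}∫_{L⁺_∞} ω_∞·ARCH₃^{−z}‖ ≤ M·∫ ARCH₃^{−Re z} d(μ_{E,∞} ⊗ μ_{F,∞})` for `1 < Re z` (Fubini + `norm_archAmplitude_le`).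
[cite: MoeglinWaldspurger1995, II.1.7] -/
theorem norm_integral_integral_archAmplitude_le
    (hω : AEStronglyMeasurable (fun p : InfiniteAdeleRing L × InfiniteAdeleRing ↥(maximalRealSubfield L) => ωinf p.1 p.2) (μE₁.prod μF₁)) {M : ℝ} (hωb : ∀ Xi a, ‖ωinf Xi a‖ ≤ M)
    {z : ℂ} (hz : 1 < z.re) :
    ‖∫ Xi : InfiniteAdeleRing L, ∫ a : InfiniteAdeleRing ↥(maximalRealSubfield L), ωinf Xi a * ((((∏ w : InfinitePlace L, ((1 + ‖(Xi) w‖ ^ 2 / 2) ^ 2 + (w δ) ^ 2 * (((InfiniteAdeleRing.ringEquiv_mixedSpace ↥(maximalRealSubfield L)) a).1 ⟨w.comap (algebraMap ↥(maximalRealSubfield L) L), K2E1HeightBigCellLineFormulaU2.isReal_comap_maximalRealSubfield L w⟩) ^ 2))) : ℝ) : ℂ) ^ (-z) ∂μF₁ ∂μE₁‖ ≤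
      M * ∫ p : InfiniteAdeleRing L × InfiniteAdeleRing ↥(maximalRealSubfield L), (∏ w : InfinitePlace L, ((1 + ‖(p.1) w‖ ^ 2 / 2) ^ 2 + (w δ) ^ 2 * (((InfiniteAdeleRing.ringEquiv_mixedSpace ↥(maximalRealSubfield L)) p.2).1 ⟨w.comap (algebraMap ↥(maximalRealSubfield L) L), K2E1HeightBigCellLineFormulaU2.isReal_comap_maximalRealSubfield L w⟩) ^ 2)) ^ (-z.re) ∂(μE₁.prod μF₁) := by
  haveI : SecondCountableTopology (InfiniteAdeleRing L) := secondCountableTopology_infiniteAdeleRing L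
  haveI : SecondCountableTopology (InfiniteAdeleRing ↥(maximalRealSubfield L)) := secondCountableTopology_infiniteAdeleRing _
  have heq : (∫ Xi : InfiniteAdeleRing L, ∫ a : InfiniteAdeleRing ↥(maximalRealSubfield L), ωinf Xi a * ((((∏ w : InfinitePlace L, ((1 + ‖(Xi) w‖ ^ 2 / 2) ^ 2 + (w δ) ^ 2 * (((InfiniteAdeleRing.ringEquiv_mixedSpace ↥(maximalRealSubfield L)) a).1 ⟨w.comap (algebraMap ↥(maximalRealSubfield L) L), K2E1HeightBigCellLineFormulaU2.isReal_comap_maximalRealSubfield L w⟩) ^ 2))) : ℝ) : ℂ) ^ (-z) ∂μF₁ ∂μE₁) =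
      ∫ p : InfiniteAdeleRing L × InfiniteAdeleRing ↥(maximalRealSubfield L), ωinf p.1 p.2 * ((((∏ w : InfinitePlace L, ((1 + ‖(p.1) w‖ ^ 2 / 2) ^ 2 + (w δ) ^ 2 * (((InfiniteAdeleRing.ringEquiv_mixedSpace ↥(maximalRealSubfield L)) p.2).1 ⟨w.comap (algebraMap ↥(maximalRealSubfield L) L), K2E1HeightBigCellLineFormulaU2.isReal_comap_maximalRealSubfield L w⟩) ^ 2))) : ℝ) : ℂ) ^ (-z) ∂(μE₁.prod μF₁) :=
    (integral_prod _ (integrable_archAmplitude_of_norm_le L hδ μE₁ μF₁ ωinf hω hωb hz)).symm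
  rw [heq]
  exact norm_archAmplitude_le L hδ μE₁ μF₁ ωinf hωb hz

end Arch

/-! ## §3 ★ (a-3)'s χ-amplitude with an archimedean weight of any bound -/

section Amplitude

variable [MeasurableSpace (InfiniteAdeleRing L)] [BorelSpace (InfiniteAdeleRing L)] [MeasurableSpace (InfiniteAdeleRing ↥(maximalRealSubfield L))] [BorelSpace (InfiniteAdeleRing ↥(maximalRealSubfield L))]
  (μE₁ : Measure (InfiniteAdeleRing L)) [μE₁.IsAddHaarMeasure] (μF₁ : Measure (InfiniteAdeleRing ↥(maximalRealSubfield L))) [μF₁.IsAddHaarMeasure]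
  [∀ v : HeightOneSpectrum (𝓞 ↥(maximalRealSubfield L)), MeasurableSpace (v.adicCompletion ↥(maximalRealSubfield L))] [∀ v : HeightOneSpectrum (𝓞 ↥(maximalRealSubfield L)), BorelSpace (v.adicCompletion ↥(maximalRealSubfield L))]
  (νv : ∀ v : HeightOneSpectrum (𝓞 ↥(maximalRealSubfield L)), Measure (v.adicCompletion ↥(maximalRealSubfield L))) [∀ v, (νv v).IsAddHaarMeasure]

include hd in
/-- **THE χ-INTERTWINING AMPLITUDE `A(z) = C·(∫_{L_∞}∫_{L⁺_∞} ω_∞·ARCH₃^{−z})·∏_{v ∈ S₀} ν_v(𝒪_v³)⁻¹•∫ ω_v·Q_v^{−z}` IS HOLOMORPHIC ON `{1 < Re z}` WITH AN ARCHIMEDEAN WEIGHT OF ANY BOUND `M`**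
(finite weights `‖ω_v‖ ≤ 1` on `S₀` as in ★ (a-3); §1 iterated form × ★ `differentiableOn_finsetProd_chiLocalMean_three`). [cite: MoeglinWaldspurger1995, IV.1.11] [cite: Langlands1976, Appendix]
[cite: Titchmarsh1939, §2.8] -/
theorem differentiableOn_chiAmplitude_three_of_norm_le (C : ℂ) (S₀ : Finset (HeightOneSpectrum (𝓞 ↥(maximalRealSubfield L))))
    (ω : ∀ v : HeightOneSpectrum (𝓞 ↥(maximalRealSubfield L)), (Fin 3 → v.adicCompletion ↥(maximalRealSubfield L)) → ℂ)
    (hω : ∀ v ∈ S₀, AEStronglyMeasurable (ω v) (Measure.pi fun _ : Fin 3 => νv v)) (hωb : ∀ v ∈ S₀, ∀ p, ‖ω v p‖ ≤ 1)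
    (ωinf : InfiniteAdeleRing L → InfiniteAdeleRing ↥(maximalRealSubfield L) → ℂ)
    (hωinf : AEStronglyMeasurable (fun p : InfiniteAdeleRing L × InfiniteAdeleRing ↥(maximalRealSubfield L) => ωinf p.1 p.2) (μE₁.prod μF₁)) {M : ℝ} (hωinfb : ∀ Xi a, ‖ωinf Xi a‖ ≤ M) :
    DifferentiableOn ℂ (fun z : ℂ => C * (∫ Xi : InfiniteAdeleRing L, ∫ a : InfiniteAdeleRing ↥(maximalRealSubfield L),
        ωinf Xi a * ((((∏ w : InfinitePlace L, ((1 + ‖(Xi) w‖ ^ 2 / 2) ^ 2 + (w δ) ^ 2 * (((InfiniteAdeleRing.ringEquiv_mixedSpace ↥(maximalRealSubfield L)) a).1 ⟨w.comap (algebraMap ↥(maximalRealSubfield L) L), K2E1HeightBigCellLineFormulaU2.isReal_comap_maximalRealSubfield L w⟩) ^ 2))) : ℝ) : ℂ) ^ (-z) ∂μF₁ ∂μE₁) *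
      ∏ v ∈ S₀, ((Measure.pi fun _ : Fin 3 => νv v) (integralBox ↥(maximalRealSubfield L) (Fin 3) v)).toReal⁻¹ •
        ∫ p : Fin 3 → v.adicCompletion ↥(maximalRealSubfield L),
          ω v p * (((∏ w' : PlacesOver L v, max 1 (max ((normAbs (w'.1.adicCompletion L) (quadraticLocalEquiv L v (IsCMField.complexConj L) hcδ hδ (p 0, p 1) w') : ℝ≥0) : ℝ)
            ((normAbs (w'.1.adicCompletion L) ((toLocalRing L v (p 2) * algebraMap L (LocalRing L v) δ -
              toLocalRing L v 2⁻¹ * (quadraticLocalEquiv L v (IsCMField.complexConj L) hcδ hδ (p 0, p 1) *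
                conjLocal L (IsCMField.complexConj L) v (quadraticLocalEquiv L v (IsCMField.complexConj L) hcδ hδ (p 0, p 1)))) w') : ℝ≥0) : ℝ))) : ℝ) : ℂ) ^ (-z) ∂(Measure.pi fun _ : Fin 3 => νv v)) {z : ℂ | 1 < z.re} :=
  (((differentiableOn_integral_integral_archAmplitude_of_norm_le L hδ μE₁ μF₁ ωinf hωinf hωinfb).const_mul C).mul
    (differentiableOn_finsetProd_chiLocalMean_three L hcδ hδ hd νv S₀ ω hω hωb))

end Amplitude

end Summit.HodgeConjecture.HodgeConjecture.Cruxes.H413.K2E1ChiArchAmplitudeOfKTypeVectorU3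

end
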